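import Literature.NumberTheory.GaloisCohomology.Howard2004.DVRLevelLiftabilityProofs
import Literature.NumberTheory.GaloisCohomology.Howard2004.TransverseCartesianProofs
import Literature.NumberTheory.GaloisCohomology.Howard2004.TransverseScalarStableProofs
import HarnessLib

/-!
# Howard 2004, Lemma 1.6.3 / the «liftability» step of Lemma 1.6.4 AT LEVEL `n` on a `DVRSetting`:
# the modified structure `𝓕(n)` on the levels `T^{(k)} ↔ T^{(k+d)}` (theorems only)

Topic `NumberTheory/GaloisCohomology/Howard2004`; namespace
`Literature.NumberTheory.GaloisCohomology.Howard2004`.  THEOREMS ONLY: no definition, no named fact, no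
instance, no notation, no `sorry`.  Sequel to `DVRLevelLiftabilityProofs` (§5, the liftability step for ANY
family of Selmer structures on the tower given Lemma 1.3.3's descent) and to `TransverseCartesianProofs`
(x10b-p1-w2 g15: Howard's Lemma 1.5.1 H.3-clause for the transverse condition and Lemma 1.3.3 AT LEVEL `n`,
`DVRSetting.exists_mem_selmerGroup_atLevel_incH1LE_eq`) and `TransverseScalarStableProofs` (the transverse
condition is an `R`-submodule).

WHY (INPUTS row G87 = `Howard2004.thm161_dvrKolyvaginBound` = Howard Thm. 1.6.1; stub `stub_h161` of the μ-crux
stmt-BirchSwinnertonDyer-22642; cell `pub/bsd-print-x9`, seat `bsd-line-x10b-p1-w7` g7, brick (LIFT)).  The proof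
of Lemma 1.6.4 (arXiv:1202.6340 p. 11 L82 – p. 12 L27) runs over ALL `n ∈ 𝓝^{(2k-1)}`, in the Selmer groups
`H¹_{𝓕(n)}(K, T^{(k)})` of the MODIFIED structure `𝓕(n)` (transverse at the primes of `n`, Def. 1.2.2); its first
case is

> First suppose `Stub^{(k)}(n) ≠ 0` … this is equivalent to `π^{k-i} κ_n^{(k)} = 0`.  Now by Lemma (liftability)
> [= Lemma 1.6.3], `κ_n^{(k)}` is divisible by `πⁱ` in `H¹_{𝓕(n)}(K, T^{(k)})`, proving this special case.

This file is that sentence for `𝓕(n)` on the tower levels (for `n` whose primes' transverse fixers act trivially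
on the levels used — Howard's `n ∈ 𝓝^{(k)}`, `I_n T^{(k)} = 0`, hypothesis `htriv` of `TransverseCartesianProofs`):

* §1 `DVRSetting.scalarMapH1_mem_selmerGroup_atLevel` — `H¹_{𝓕(n)}(K, T^{(k)})` is `R`-stable (the conditions of
  `𝓕` are `R`-submodules by `SatisfiesH.cond_smul`, the transverse ones by `isScalarStable_transverseStructure`);
* §2 **`DVRSetting.exists_mem_selmerGroup_atLevel_eq_scalarMapH1_pow_of_incH1LE_eq`** — THE LIFTABILITY STEP AT
  LEVEL `n`: with the printed structure `θ' : H¹_{𝓕(n)}(K, T^{(k+d)}) ≃ (Fin ε → R/𝔪^{e_{k+d}}) × (M' × M')`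
  (Thm. 1.4.2 for `(T^{(k+d)}, 𝓕(n))`, additive `R`-equivariant) and `π^{e_{k+d}-e_k} M' = 0`, a class `c` with
  `H¹(inc)(c) = π^{e_{k+d}-e_k} c'`, `c'` an `𝓕(n)`-Selmer class, and `π^j c = 0` (`j ≤ e_k`) is `π^{e_k-j} y` for an
  `𝓕(n)`-Selmer class `y ∈ H¹_{𝓕(n)}(K, T^{(k)})` — `DVRLevelLiftabilityProofs` §5 with the descent supplied by
  `exists_mem_selmerGroup_atLevel_incH1LE_eq`.

HONEST FRAMING: Lemma 1.6.4, Thm. 1.6.1 and `thm161_dvrKolyvaginBound` are NOT proved here (the structure `θ'`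
for `(T^{(k+d)}, 𝓕(n))` is Thm. 1.4.2's, an input; the induction is `StubLemmaInductionProofs`'); no summit
statement is proved; the Birch–Swinnerton-Dyer conjecture is not proved by any of this.
References: [Howard2004HeegnerKolyvagin] Lemma 1.6.3, Lemma 1.6.4 (proof), Def. 1.2.2, Lemma 1.5.1, Lemma 1.3.3
(arXiv:1202.6340 p. 11 L69–80, p. 12 L1–9, p. 6 L101–125, p. 9 L124–128, p. 7 L152–160);
[MazurRubinMemoirs2004] Lemma 3.5.4, Lemma 3.7.4.
-/

set_option autoImplicit false

noncomputable section

open Function NumberField IsDedekindDomain Field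
open scoped NumberField ContRepresentation

namespace Literature.NumberTheory.GaloisCohomology.Howard2004

open Literature.NumberTheory.GaloisRepresentations
open Literature.NumberTheory.GaloisRepresentations.DiscreteGaloisModule
open Literature.NumberTheory.GaloisRepresentations.galoisCohomology

namespace DVRSetting

variable {p : ℕ} [Fact p.Prime] {K : Type} [Field K] [NumberField K]
  {R : Type} [CommRing R] [IsDomain R] [IsDiscreteValuationRing R] [Algebra ℤ_[p] R]
  {N : ℕ → Type} [∀ k, AddCommGroup (N k)] [∀ k, TopologicalSpace (N k)]
  [∀ k, DiscreteTopology (N k)] [∀ k, Module R (N k)]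
  {Rk : ℕ → Type} [∀ k, CommRing (Rk k)] [∀ k, IsLocalRing (Rk k)] [∀ k, TopologicalSpace (Rk k)]
  [∀ k, DiscreteTopology (Rk k)] [∀ k, Algebra ℤ_[p] (Rk k)] [∀ k, Algebra R (Rk k)]
  [∀ k, Module (Rk k) (N k)] [∀ k, IsScalarTower R (Rk k) (N k)]
  {Nbar : Type} [AddCommGroup Nbar] [TopologicalSpace Nbar] [DiscreteTopology Nbar]
  [∀ k, Module (Rk k) Nbar]
  {Nq : ℕ → Finset (HeightOneSpectrum (𝓞 K)) → Type} [∀ k n, AddCommGroup (Nq k n)]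
  [∀ k n, TopologicalSpace (Nq k n)] [∀ k n, DiscreteTopology (Nq k n)]
  [∀ k n, Module (Rk k) (Nq k n)] [∀ k n, Module R (Nq k n)]
  [∀ k n, IsScalarTower R (Rk k) (Nq k n)]

/-! ## §1 `H¹_{𝓕(n)}(K, T^{(k)})` is `R`-stable -/

/-- **The `𝓕(n)`-Selmer group of a level is `R`-stable**: the local conditions of `𝓕` are `R`-submodules
(`SatisfiesH.cond_smul`) and so are Howard's transverse conditions (`isScalarStable_transverseStructure`), hence
every condition of `𝓕(n) = 𝓕` modified transversally at the primes of `n` (`IsScalarStable.modify`), and the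
Selmer group of a scalar-stable structure is stable (`SelmerStructure.scalarMapH1_mem_selmerGroup`).
[cite: Howard2004HeegnerKolyvagin, Def. 1.1.1, Def. 1.1.10 and Def. 1.2.2 (arXiv p. 5 L20–24, p. 6 L14–24, L101–125)] -/
theorem scalarMapH1_mem_selmerGroup_atLevel (S : DVRSetting p K R N Rk Nbar Nq) (hy : S.SatisfiesH) (k : ℕ)
    (n : Finset (HeightOneSpectrum (𝓞 K))) (r : R) {y : galoisCohomology (S.T.ρ k) 1}
    (hy' : y ∈ (((S.t k).atLevel S.jbar n).cond).selmerGroup) :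
    scalarMapH1 (S.T.ρ k) (S.T.hlin k) r y ∈ (((S.t k).atLevel S.jbar n).cond).selmerGroup := by
  have hc : (S.t k).cond.IsScalarStable (S.T.hlin k) := fun v r x hx => hy.cond_smul k v r ⟨x, hx, rfl⟩
  have htr : (transverseStructure p (S.T.ρ k) S.jbar).IsScalarStable (S.T.hlin k) :=
    isScalarStable_transverseStructure p (S.T.hlin k) S.jbar
  exact SelmerStructure.scalarMapH1_mem_selmerGroup (S.T.hlin k)
    (SelmerStructure.IsScalarStable.modify (S.T.hlin k) hc htr ∅ ∅ n) r hy'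

/-! ## §2 The liftability step for `𝓕(n)` on the levels `k ≤ k + d` -/

/-- **Howard 2004, the «liftability» step of Lemma 1.6.4 (= Lemma 1.6.3) AT LEVEL `n`, on a `DVRSetting` with
H.0–H.5**, levels `k ≤ k + d`, for a finite set of primes `n` whose transverse fixers act trivially on the levels
`≤ k + d` (`htriv`, Howard's `n ∈ 𝓝^{(k+d)}`).  Data: the printed structure
`θ' : H¹_{𝓕(n)}(K, T^{(k+d)}) ≃ (Fin ε → R/𝔪^{e_{k+d}}) × (M' × M')` (Thm. 1.4.2 for the triple `(T^{(k+d)}, 𝓕(n))`,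
additive and `R`-equivariant, any `ε`) with `π^{e_{k+d}-e_k} M' = 0` (Howard: `len M^{(2k-1)}(n) ≤ k - 1`).
Claim: if `H¹(inc_{k→k+d})(c) = π^{e_{k+d}-e_k} c'` with `c'` an `𝓕(n)`-Selmer class of level `k + d` (i.e. `c`
is the reduction of `c'` read through Lemma 1.3.3) and `π^j c = 0`, `j ≤ e_k`, then `c = π^{e_k-j} y` for an
`𝓕(n)`-SELMER class `y` of level `k`.  Proof: `DVRLevelLiftabilityProofs` §5
(`exists_mem_selmerGroup_eq_scalarMapH1_pow_of_incH1LE_eq_of_descent`) with the `R`-stability §1 and Lemma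
1.3.3's descent at level `n` (`exists_mem_selmerGroup_atLevel_incH1LE_eq`, x10b-p1-w2).
[cite: Howard2004HeegnerKolyvagin, Lemma 1.6.3 and Lemma 1.6.4 (proof) = arXiv:1202.6340 p. 11 L69–80; p. 12 L1–9]
[cite: MazurRubinMemoirs2004, Lemma 3.5.4 and Lemma 3.7.4] -/
theorem exists_mem_selmerGroup_atLevel_eq_scalarMapH1_pow_of_incH1LE_eq (S : DVRSetting p K R N Rk Nbar Nq)
    (hy : S.SatisfiesH) (hπm : S.π ∈ IsLocalRing.maximalIdeal R) (hle : ∀ k, S.e k ≤ S.e (k + 1))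
    (n : Finset (HeightOneSpectrum (𝓞 K))) (k d : ℕ)
    (htriv : ∀ j, j ≤ k + d → ∀ w ∈ n, ∀ g ∈ transverseFixer p (residueChar w) S.jbar w, ∀ y : N j,
      GaloisRep.toLocal w (S.T.ρ j) g y = y)
    {ε : ℕ} {M' : Type} [AddCommGroup M'] [Module R M']
    (θ' : ↥((((S.t (k + d)).atLevel S.jbar n).cond).selmerGroup) ≃+
      ((Fin ε → R ⧸ IsLocalRing.maximalIdeal R ^ S.e (k + d)) × (M' × M')))
    (hθ' : ∀ (r : R) (y : galoisCohomology (S.T.ρ (k + d)) 1)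
      (hy' : y ∈ (((S.t (k + d)).atLevel S.jbar n).cond).selmerGroup),
      θ' ⟨scalarMapH1 (S.T.ρ (k + d)) (S.T.hlin (k + d)) r y,
          S.scalarMapH1_mem_selmerGroup_atLevel hy (k + d) n r hy'⟩ = r • θ' ⟨y, hy'⟩)
    (hM' : ∀ m : M', S.π ^ (S.e (k + d) - S.e k) • m = 0)
    {c : galoisCohomology (S.T.ρ k) 1} {c' : galoisCohomology (S.T.ρ (k + d)) 1}
    (hc' : c' ∈ (((S.t (k + d)).atLevel S.jbar n).cond).selmerGroup)
    (hcc' : AdicTower.incH1LE S.T S.π S.e hy.killed hy.ker_red hπm hle k (k + d) (Nat.le_add_right k d) c =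
      scalarMapH1 (S.T.ρ (k + d)) (S.T.hlin (k + d)) (S.π ^ (S.e (k + d) - S.e k)) c')
    {j : ℕ} (hj : j ≤ S.e k) (h0 : scalarMapH1 (S.T.ρ k) (S.T.hlin k) (S.π ^ j) c = 0) :
    ∃ y ∈ (((S.t k).atLevel S.jbar n).cond).selmerGroup,
      c = scalarMapH1 (S.T.ρ k) (S.T.hlin k) (S.π ^ (S.e k - j)) y :=
  S.exists_mem_selmerGroup_eq_scalarMapH1_pow_of_incH1LE_eq_of_descent hy hπm hle k d
    (fun i => ((S.t i).atLevel S.jbar n).cond)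
    (fun i r _ hy' => S.scalarMapH1_mem_selmerGroup_atLevel hy i n r hy')
    (fun c hc hc0 => S.exists_mem_selmerGroup_atLevel_incH1LE_eq hy hπm hle n (k + d) htriv k d le_rfl c hc hc0)
    θ' hθ' hM' hc' hcc' hj h0

end DVRSetting

end Literature.NumberTheory.GaloisCohomology.Howard2004

end
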